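import Summits.AtomisticToContinuum.HydrodynamicLimit.Theses.CollisionIsometryCLT
import Summits.AtomisticToContinuum.HydrodynamicLimit.Theses.StiffCollisionalRelaxation
import Literature.Analysis.FluidPDE.CollisionalTransferTimeDep
import Literature.Analysis.FluidPDE.CollisionalTransferFunctional

/-!
# `CollisionalTransferLocality` (stmt-AtomisticToContinuum-9518) — line `conditional-covariance-liouville-rigidity`

Crux (route `CollisionIsometryCLT`, rank 4; shared verbatim with `StiffCollisionalRelaxation` K2):
`Summit.AtomisticToContinuum.HydrodynamicLimit.Theses.CollisionIsometryCLT.CollisionalTransferLocality` —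
w.h.p. under the local Gibbs law, uniformly in `τ ≤ t`, the Irving–Kirkwood collisional residual `Cc(τ)` of the
`(ψ, χ)`-tested momentum + energy balance equals `∫₀^τ∫ (div ψ + ∇χ·ū) p_c(ρ̄, θ̄)`,
`p_c = hsPressure σ ρ θ − ρθ = ρθ(Z(ρσ³) − 1)`.

Line (idea card `Cruxes/CollisionalTransferLocality/Ideas/conditional-covariance-liouville-rigidity.md`, triage
r1-1/2/3 pass): Olla–Varadhan–Yau's local ergodic theorem (OllaVaradhanYau1993 §4 (A)–(E)) with the only noisy
step (B) replaced by a MOMENT-level input — the velocities are conditionally centred-Maxwellian to order 3 GIVEN the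
microscopic configuration around a particle (`stub_conditionalCovariance`, the Transfer C⁺ of the card, the bet this
line shares with the route engine 12949) — after which free local stationarity of space–time blow-ups tested on
velocity-linear observables forces the positional law off contacts to have zero distributional gradient
(covariance-rigidity core, IdeatorOneSketch `CovarianceRigidityCore`), i.e. to be canonical hard-core DLR, hence
(two-block purity, low-density uniqueness) THE hard-sphere Gibbs law at the block density; its contact statistics are
then the Gibbs ones: contact density `6(Z(ρ̄σ³) − 1)` ordered contacts per particle per unit shell thickness,
isotropic normals, de-fluxed normal second moment `θ̄`, vanishing flux-weighted odd moment (`stub_gibbsContactRigidity`,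
the engine). The collision sums of the crux are the `h → 0` trace of these thin-shell statistics
(`stub_contactReadout`), and `Cc` IS the collision-jump sum pathwise (`stub_irvingKirkwoodIdentity`). The two
debts every rigidity line on this crux owes (triage X2, X3) are typed as their own stubs: a-priori microstructure
bounds incl. two-block purity and the block chamber (`stub_microstructureBounds`; the crux stands alone and may
not borrow `AprioriBounds (ii)`, Disproof.lean §1), and the pressure equation identifying the canonical contact value
with the derivative of the tree's `limsup` free energy (`stub_pressureEquation`, statics).

* `stub_conditionalCovariance`  — C⁺: local-functional-weighted velocity moments of orders 2 and 3 are Maxwellian at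
  the block temperature, time-integrated, in probability (XL; the bet; unconditional — no forest conditioning).
* `stub_microstructureBounds`   — block chamber `c₁ ≤ ρ̄`, `ρ̄σ³ ≤ η₁`; time-averaged 6th velocity moment; second
  moment of the per-particle cumulative momentum transfer; two-block purity (micro-ball counts = block density) (L).
* `stub_pressureEquation`       — statics: thin-shell ordered-pair count under the invariant law, per unit thickness,
  tends to `6(Z(σ³) − 1)` for `σ³ < η₀` (L; Ruelle1969 §3.4, §4; LebowitzPenrose1964; the (X3) debt).
* `stub_gibbsContactRigidity`   — ENGINE: pressure equation → C⁺ → bounds → Gibbs contact trace (XL, hardest).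
* `stub_contactReadout`         — Irving–Kirkwood identity → Gibbs contact trace → bounds → the crux's conclusion at
  `(σ, Φ)` (L; flux-through-shell = collisions as `h → 0` uniformly in `N`, hemisphere moments, midpoint Taylor,
  `ρθ · 6(Z−1) · θ̄/6 = p_c`, `sup_τ`).
* `stub_irvingKirkwoodIdentity` — `Cc(τ) = Σ_{t_c ≤ τ}` jumps of the frozen-time observable, in probability (M,
  provable now from `IsHardSphereTrajectory.sub_eq_integral_add_finsum_collisionJump_td`).

Composition `CollisionalTransferLocality_of`: `η₀` from the pressure equation, `η₁ := η₀/2`; `σ₀ := min` of the five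
thresholds and `1/2`; at `(σ, Φ)` pure modus ponens (all interfaces are docked on the literal route terms, matched by
ζ-reduction of the common `let` prefix). Disproof.lean (cdisprove cycle 1) proves NO `_false_without_` obstruction;
`collisionalPressure_sigma_zero` (both sides `O(σ³)`) and the EOS-blind `EquilibriumRung` are respected: no stub is an
equilibrium statement about `Cc`, and the only equilibrium stub (`stub_pressureEquation`) is about the UNTESTED contact
count, which does see the EOS. All statements are on the literal route terms (no local abbreviations), so that each stub
can land verbatim as a `--supports` helper.
-/

noncomputable section

namespace Summit.AtomisticToContinuum.HydrodynamicLimit.Cruxes.CollisionalTransferLocality.ConditionalCovarianceLiouvilleRigidity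

open scoped BigOperators Topology Manifold Classical MeasureTheory ProbabilityTheory Matrix InnerProductSpace ComplexConjugate ContinuousMap
open Filter Set Function TopologicalSpace MeasureTheory

/-! ### The six stubs (to be registered on stmt-AtomisticToContinuum-9518) -/

/-- STUB C⁺ (XL — the bet; the card's Transfer, sharpened by triage r1-1 to ALL local `m`-body weights and stated
UNCONDITIONALLY, triage r1-2 (b): no forest conditioning). **Velocity moments of orders 2 and 3 are centred-Maxwellian at
the block temperature GIVEN the microscopic configuration.** For every `m`, every bounded continuous compactly supported
weight `W` of the `m` blown-up relative positions `(N+1)^{1/3}·reprSym(x_{j_k} − x_i)` of an ordered `m`-tuple of distinct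
neighbours of particle `i` (contact shell included), every continuous macroscopic localisation `χ`, the time-integrated
statistics `(N+1)⁻¹ Σ_i Σ_j χ(x_i) W(…) · [Π (v_slot − ū(x_i))_comp − Maxwellian value]` over the tagged
`(m+1)`-tuple (slot `0` = `i`, slot `k+1` = `j_k`) tend to `0` in probability, where the Maxwellian value is
`θ̄(x_i) δ_{slots} δ_{comps}` at order 2 and `0` at order 3. Exactly true under the invariant Gibbs law (positions ⫫ iid
Maxwellian velocities, `O_P(N^{-1/2})`); false at `σ = 0` like the kinetic target 9522, of which the `m = 0` order-2
instance is the block-traceless-stress half. Its content is dynamical local equilibrium of velocity MOMENTS ≤ 3 at the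
contact scale — the same hidden input as `AdaptedWeightCLT` (12949: decorrelation of ancestor velocities at kinetic
separations), not an identity of the transfer isometry (triage X1). Cheapest falsifier: EDMD two-temperature relaxation,
shell-conditioned cross-covariance vs. the unconditional traceless stress (card, falsifier (b)). Sources:
OllaVaradhanYau1993 §4 (B); FritzFunakiLebowitz1994 Thm 1; Spohn1991 Part I §3.2. [folklore] -/
theorem stub_conditionalCovariance :
    ∀ (a₀ θ₀ : (UnitAddTorus (Fin 3)) → ℝ) (u₀ : (UnitAddTorus (Fin 3)) → (EuclideanSpace ℝ (Fin 3))), Continuous a₀ →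
      Continuous θ₀ → Continuous u₀ → (∀ x, 0 < a₀ x) → (∀ x, 0 < θ₀ x) → ∃ σ₀ : ℝ, 0 < σ₀ ∧ ∀ σ : ℝ, 0 < σ → σ <
      σ₀ → ∀ Φ : (N : ℕ) → Literature.Analysis.FluidPDE.HardSphereFlow (Literature.Analysis.FluidPDE.Torus.geometry (Fin 3)) (Literature.MathematicalPhysics.KineticTheory.hsDiameter σ N) (N +
      1), ∀ (γ C : ℝ) (φ : ℕ → (UnitAddTorus (Fin 3)) → ℝ), 0 < γ → γ ≤ 1 / 15 → ((∀ N, Literature.Analysis.FunctionSpaces.Torus.IsSmooth (φ N)) ∧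
      (∀ N y, 0 ≤ φ N y) ∧ (∀ N, ∫ y, φ N y = 1) ∧ (∀ (N : ℕ) y, ((N : ℝ) + 1) ^ (-γ) ≤ Literature.Analysis.FluidPDE.Torus.euclidDist y 0 →
      φ N y = 0) ∧ (∀ (N : ℕ) y, φ N y ≤ C * ((N : ℝ) + 1) ^ (3 * γ)) ∧ (∀ (N : ℕ) y, ‖Literature.Analysis.FunctionSpaces.Torus.gradient (φ N) y‖ ≤
      C * ((N : ℝ) + 1) ^ (4 * γ))) →
    let ρb := fun (N : ℕ) (z : Literature.Analysis.FluidPDE.Config (N + 1) (Fin 3) (UnitAddTorus (Fin 3))) (x :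
      (UnitAddTorus (Fin 3))) => Literature.MathematicalPhysics.KineticTheory.empiricalDensityField z (fun y =>
      φ N (y - x));
    let mb := fun (N : ℕ) (z : Literature.Analysis.FluidPDE.Config (N + 1) (Fin 3) (UnitAddTorus (Fin 3))) (x :
      (UnitAddTorus (Fin 3))) => Literature.MathematicalPhysics.KineticTheory.empiricalMomentumField z (fun y =>
      φ N (y - x));
    let Eb := fun (N : ℕ) (z : Literature.Analysis.FluidPDE.Config (N + 1) (Fin 3) (UnitAddTorus (Fin 3))) (x :
      (UnitAddTorus (Fin 3))) => Literature.MathematicalPhysics.KineticTheory.empiricalEnergyField z (fun y =>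
      φ N (y - x));
    let ub := fun (N : ℕ) (z : Literature.Analysis.FluidPDE.Config (N + 1) (Fin 3) (UnitAddTorus (Fin 3))) (x :
      (UnitAddTorus (Fin 3))) => (ρb N z x)⁻¹ • mb N z x;
    let θb := fun (N : ℕ) (z : Literature.Analysis.FluidPDE.Config (N + 1) (Fin 3) (UnitAddTorus (Fin 3))) (x :
      (UnitAddTorus (Fin 3))) => 2 / 3 * (Eb N z x / ρb N z x - ‖mb N z x‖ ^ 2 / (2 * ρb N z x ^ 2)); ∀ (m : ℕ) (W :
      (Fin m → (EuclideanSpace ℝ (Fin 3))) → ℝ) (χ : (UnitAddTorus (Fin 3)) → ℝ), Continuous W → HasCompactSupport W →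
      (∀ r, |W r| ≤ 1) → Continuous χ → (∀ x, |χ x| ≤ 1) →
    let w := fun (N : ℕ) (z : Literature.Analysis.FluidPDE.Config (N + 1) (Fin 3) (UnitAddTorus (Fin 3))) (i :
      Fin (N + 1)) (j : Fin m ↪ Fin (N + 1)) => (if ∀ k, j k ≠ i then χ (z i).1 * W (fun k => (((N : ℝ) + 1) ^
      ((1 : ℝ) / 3)) • Literature.Analysis.FluidPDE.Torus.reprSym ((z (j k)).1 - (z i).1)) else 0);
    let tup := fun (N : ℕ) (i : Fin (N + 1)) (j : Fin m ↪ Fin (N + 1)) => (Matrix.vecCons i (fun k => j k) : Fin (m +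
      1) → Fin (N + 1));
    let S₂ := fun (N : ℕ) (z : Literature.Analysis.FluidPDE.Config (N + 1) (Fin 3) (UnitAddTorus (Fin 3))) (k₀ k₁ :
      Fin (m + 1)) (a b : Fin 3) => ((N : ℝ) + 1)⁻¹ * ∑ i : Fin (N + 1), ∑ j : (Fin m ↪ Fin (N + 1)), w N z i j *
      (((z (tup N i j k₀)).2 a - ub N z (z i).1 a) * ((z (tup N i j k₁)).2 b - ub N z (z i).1 b) - (if k₀ = k₁ ∧
      a = b then θb N z (z i).1 else 0));
    let S₃ := fun (N : ℕ) (z : Literature.Analysis.FluidPDE.Config (N + 1) (Fin 3) (UnitAddTorus (Fin 3))) (k₀ k₁ k₂ :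
      Fin (m + 1)) (a b c : Fin 3) => ((N : ℝ) + 1)⁻¹ * ∑ i : Fin (N + 1), ∑ j : (Fin m ↪ Fin (N + 1)), w N z i j *
      (((z (tup N i j k₀)).2 a - ub N z (z i).1 a) * ((z (tup N i j k₁)).2 b - ub N z (z i).1 b) * ((z (tup N i j k₂)).2 c -
      ub N z (z i).1 c)); ∀ t : ℝ, 0 < t → ∀ δ : ℝ, 0 < δ → (∀ (k₀ k₁ : Fin (m + 1)) (a b : Fin 3), Tendsto (fun N :
      ℕ => Literature.MathematicalPhysics.KineticTheory.localGibbsLaw σ a₀ u₀ θ₀ N (Φ N) {z | δ < |∫ s in Icc 0 t,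
      S₂ N ((Φ N).flow s z) k₀ k₁ a b|}) atTop (𝓝 0)) ∧ (∀ (k₀ k₁ k₂ : Fin (m + 1)) (a b c : Fin 3), Tendsto (fun N :
      ℕ => Literature.MathematicalPhysics.KineticTheory.localGibbsLaw σ a₀ u₀ θ₀ N (Φ N) {z | δ < |∫ s in Icc 0 t,
      S₃ N ((Φ N).flow s z) k₀ k₁ k₂ a b c|}) atTop (𝓝 0)) := by
  sorry

/-- STUB (L — a-priori bounds along the flow; the crux STANDS ALONE, Disproof.lean §1, and triage X2: entropy `O(N)` does
not supply contact-scale configurational bounds — rattler-cage family `cage_entropy.py`). For every density ceiling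
`η₁ > 0`, for all profiles there is `σ₀` such that for `σ < σ₀`, every flow, every admissible kernel family and every
`t > 0`: (B0) BLOCK CHAMBER — w.h.p. no mesoscopic cell is emptier than `c₁` or denser than `η₁/σ³` on `[0, t]` (the
conclusion of `AprioriBounds (ii)` with ceiling `η₁`; re-derived, not borrowed); (B1) the time-integrated sixth velocity
moment of the empirical measure is bounded w.h.p.; (B2) the particle average of the SQUARED cumulative momentum transfer
`X_i = Σ_{collisions of i in (0,t]} ε‖Δv_i‖` (each `O(1)`: `≍ t(N+1)^{1/3}σ²√θ` collisions of size `σ(N+1)^{-1/3}√θ`) is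
bounded w.h.p. — the uniform-integrability input that kills rare violent cages in the read-out; (B3) TWO-BLOCK PURITY —
for every `δ` and all large micro-radii `R`, the neighbour count of particle `i` within blown-up distance `R`, divided by
`(4π/3)R³`, equals the block density `ρ̄(x_i)` up to `δ` in time-integrated mean square: no density structure between
the microscopic scale `(N+1)^{-1/3}` and the block scale `(N+1)^{-γ}` (the load-bearing residual of the card: an
activity-MIXTURE of Gibbs states passes every other step and gives `⟨p_c(ρ_micro)⟩ > p_c(ρ̄)` by convexity). Why
plausibly true: pre-shock Euler scaling has no source below the block scale (thermal density fluctuations at scale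
`(N+1)^{-γ′}` are `O(N^{-(1−3γ′)/2})`); after shocks it is the honest exposure (triage r1-2 remark 3: shock-generated
vorticity is volume-filling). Sources: OllaVaradhanYau1993 Lemma 4.1, 4.9–4.10; KipnisLandim1999; Disproof.lean §1;
TRIAGE-r1-3 finding 1. [folklore] -/
theorem stub_microstructureBounds :
    ∀ η₁ : ℝ, 0 < η₁ → ∀ (a₀ θ₀ : (UnitAddTorus (Fin 3)) → ℝ) (u₀ : (UnitAddTorus (Fin 3)) → (EuclideanSpace ℝ (Fin 3))),
      Continuous a₀ → Continuous θ₀ → Continuous u₀ → (∀ x, 0 < a₀ x) → (∀ x, 0 < θ₀ x) → ∃ σ₀ : ℝ, 0 < σ₀ ∧ ∀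
      σ : ℝ, 0 < σ → σ < σ₀ → ∀ Φ : (N : ℕ) → Literature.Analysis.FluidPDE.HardSphereFlow (Literature.Analysis.FluidPDE.Torus.geometry (Fin 3)) (Literature.MathematicalPhysics.KineticTheory.hsDiameter σ N) (N +
      1), ∀ (γ C : ℝ) (φ : ℕ → (UnitAddTorus (Fin 3)) → ℝ), 0 < γ → γ ≤ 1 / 15 → ((∀ N, Literature.Analysis.FunctionSpaces.Torus.IsSmooth (φ N)) ∧
      (∀ N y, 0 ≤ φ N y) ∧ (∀ N, ∫ y, φ N y = 1) ∧ (∀ (N : ℕ) y, ((N : ℝ) + 1) ^ (-γ) ≤ Literature.Analysis.FluidPDE.Torus.euclidDist y 0 →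
      φ N y = 0) ∧ (∀ (N : ℕ) y, φ N y ≤ C * ((N : ℝ) + 1) ^ (3 * γ)) ∧ (∀ (N : ℕ) y, ‖Literature.Analysis.FunctionSpaces.Torus.gradient (φ N) y‖ ≤
      C * ((N : ℝ) + 1) ^ (4 * γ))) →
    let ρb := fun (N : ℕ) (z : Literature.Analysis.FluidPDE.Config (N + 1) (Fin 3) (UnitAddTorus (Fin 3))) (x :
      (UnitAddTorus (Fin 3))) => Literature.MathematicalPhysics.KineticTheory.empiricalDensityField z (fun y =>
      φ N (y - x));
    let nb := fun (N : ℕ) (z : Literature.Analysis.FluidPDE.Config (N + 1) (Fin 3) (UnitAddTorus (Fin 3))) (i :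
      Fin (N + 1)) (R : ℝ) => ∑ j : Fin (N + 1), (if j ≠ i ∧ (((N : ℝ) + 1) ^ ((1 : ℝ) / 3)) * Literature.Analysis.FluidPDE.Torus.euclidDist (z i).1 (z j).1 ≤
      R then (1 : ℝ) else 0);
    let X := fun (N : ℕ) (z : Literature.Analysis.FluidPDE.Config (N + 1) (Fin 3) (UnitAddTorus (Fin 3))) (t :
      ℝ) => (Φ N).collisionalTransferFunctional (fun (i : Fin (N + 1)) (_ : Fin (N + 1)) (pre post : Literature.Analysis.FluidPDE.Config (N +
      1) (Fin 3) (UnitAddTorus (Fin 3))) => (Pi.single i (Literature.MathematicalPhysics.KineticTheory.hsDiameter σ N *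
      ‖(post i).2 - (pre i).2‖) : Fin (N + 1) → ℝ)) z t; ∀ t : ℝ, 0 < t → (∃ c₁ : ℝ, 0 < c₁ ∧ Tendsto (fun N :
      ℕ => Literature.MathematicalPhysics.KineticTheory.localGibbsLaw σ a₀ u₀ θ₀ N (Φ N) {z | ∃ s ∈ Icc 0 t, ∃
      x : (UnitAddTorus (Fin 3)), ρb N ((Φ N).flow s z) x < c₁ ∨ η₁ < ρb N ((Φ N).flow s z) x * σ ^ 3}) atTop (𝓝 0)) ∧
      (∃ K : ℝ, Tendsto (fun N : ℕ => Literature.MathematicalPhysics.KineticTheory.localGibbsLaw σ a₀ u₀ θ₀ N (Φ N) {z | K <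
      ∫ s in Icc 0 t, ∫ y, ‖y.2‖ ^ 6 ∂(Literature.Analysis.FluidPDE.empiricalMeasure ((Φ N).flow s z))}) atTop (𝓝 0)) ∧
      (∃ K : ℝ, Tendsto (fun N : ℕ => Literature.MathematicalPhysics.KineticTheory.localGibbsLaw σ a₀ u₀ θ₀ N (Φ N) {z | K <
      ((N : ℝ) + 1)⁻¹ * ∑ i : Fin (N + 1), (X N z t i) ^ 2}) atTop (𝓝 0)) ∧ (∀ δ : ℝ, 0 < δ → ∃ R₀ : ℝ, 0 < R₀ ∧
      ∀ R : ℝ, R₀ ≤ R → Tendsto (fun N : ℕ => Literature.MathematicalPhysics.KineticTheory.localGibbsLaw σ a₀ u₀ θ₀ N (Φ N) {z | δ <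
      ∫ s in Icc 0 t, ((N : ℝ) + 1)⁻¹ * ∑ i : Fin (N + 1), (nb N ((Φ N).flow s z) i R / (4 / 3 * Real.pi * R ^
      3) - ρb N ((Φ N).flow s z) (((Φ N).flow s z) i).1) ^ 2}) atTop (𝓝 0)) := by
  sorry

/-- STUB (L — statics; the (X3) debt of every rigidity line: EOS identification for the TREE's object). **Pressure
equation for `hsCompressibility`.** There is `η₀ > 0` such that for `σ³ < η₀`, under the flow-invariant homogeneous
local Gibbs law (`a₀ ≡ 1`, `u₀ ≡ 0`, `θ₀ ≡ θ`: the canonical hard-sphere law of `N+1` spheres of diameter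
`σ(N+1)^{-1/3}` on `𝕋³`, reduced density `σ³`), the expected number of ORDERED pairs at blown-up distance in
`(σ, σ(1+h)]` per particle, divided by `h`, is within `e` of `6 (Z(σ³) − 1)` for `h < h₀(e)` and `N ≥ N₀(e, h)`. Reading:
per particle the thin-shell count is `4π η h g(σ⁺)` (`η = σ³`), and the virial/pressure equation
`Z = 1 + (2π/3) η g(σ⁺)` gives `4πη g(σ⁺) = 6(Z − 1)`; here `Z η = 1 + η · deriv hsExcessFreeEnergy η` with
`hsExcessFreeEnergy` the `limsup` of `−N⁻¹ log hsFreeVolume` — so the stub comprises: the finite-`N` contact identity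
`−∂_d log Q_N(d) =` contact surface measure, existence of the thermodynamic limit (Ruelle1969 §3.4, subadditivity),
differentiability of `f_ex` and the limit/derivative interchange on `(0, η₀)` (low-density cluster expansion:
Ruelle1969 §4, LebowitzPenrose1964; `HsEosLowDensity` stmt-0768 territory), and convergence of the canonical pair
correlation at contact. Cheapest check: second virial coefficient, `6(Z − 1) = 4πη + O(η²)` against the ideal shell count
`4πη h`. Sources: Ruelle1969 §3.4, §4; LebowitzPenrose1964; Spohn1991 Part I (3.15) ("proved by Presutti (1975)");
HansenMcDonald `βP/ρ = 1 + (2π/3)ρσ³g(σ)`. [folklore] -/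
theorem stub_pressureEquation :
    ∃ η₀ : ℝ, 0 < η₀ ∧ ∀ σ : ℝ, 0 < σ → σ ^ 3 < η₀ → ∀ θ : ℝ, 0 < θ → ∀ e : ℝ, 0 < e → ∃ h₀ : ℝ, 0 < h₀ ∧ ∀ h :
      ℝ, 0 < h → h < h₀ → ∃ N₀ : ℕ, ∀ N : ℕ, N₀ ≤ N → ∀ Φ : Literature.Analysis.FluidPDE.HardSphereFlow (Literature.Analysis.FluidPDE.Torus.geometry (Fin 3)) (Literature.MathematicalPhysics.KineticTheory.hsDiameter σ N) (N +
      1), |h⁻¹ * (∫ z, ((N : ℝ) + 1)⁻¹ * ∑ i : Fin (N + 1), ∑ j : Fin (N + 1), (if j ≠ i ∧ σ < (((N : ℝ) + 1) ^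
      ((1 : ℝ) / 3)) * Literature.Analysis.FluidPDE.Torus.euclidDist (z i).1 (z j).1 ∧ (((N : ℝ) + 1) ^ ((1 : ℝ) /
      3)) * Literature.Analysis.FluidPDE.Torus.euclidDist (z i).1 (z j).1 ≤ σ * (1 + h) then (1 : ℝ) else 0) ∂(Literature.MathematicalPhysics.KineticTheory.localGibbsLaw σ (fun _ =>
      1) (fun _ => 0) (fun _ => θ) N Φ)) - 6 * (Literature.MathematicalPhysics.KineticTheory.hsCompressibility (σ ^
      3) - 1)| ≤ e := by
  sorry

/-- STUB (XL — THE ENGINE of the line, held by the lead; OVY §4 (C)–(E) / FFL Thm 1 transplanted to hard cores with the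
momenta hypothesis weakened to conditional moments). **Gibbs contact trace.** Given the pressure equation on `(0, η₀)`,
a ceiling `η₁ < η₀`, and at `(σ, Φ)` the conditional-covariance input C⁺ and the a-priori bounds, the thin-shell contact
statistics along the flow are the GIBBS ones: for every continuous weight `G(ω, ū)` of the contact normal and the block
velocity (`|G| ≤ 1 + ‖ū‖`) and every localisation `χ`, (trace) `h⁻¹ ∫₀ᵗ (N+1)⁻¹ Σ_{i≠j} χ(x_i) 1{σ < r_ij ≤ σ(1+h)}
((v_i − v_j)·ω_ij)₋² G(ω_ij, ū(x_i)) ds → ∫₀ᵗ∫ χ ρ̄ θ̄ · 6(Z(ρ̄σ³) − 1) · Ḡ(ū) dx ds` in probability for `h < h₀(δ)`,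
where `Ḡ(u)` is the uniform direction average of `G(·, u)` (written as an integral against the isotropic density
`localMaxwellian 1 1 0`), and (odd) the same statistic with the extra factor `(v_i + v_j − 2ū(x_i))_b` tends to `0`.
I.e.: contact density with the exact `χ(η)` to all orders in `η` (as `6(Z−1)`), isotropic normals, de-fluxed normal
second moment `E[(g·ω)₋² | q] = ½ ωᵀE[ggᵀ|q]ω = θ̄` and vanishing flux-weighted odd third moment. Intended proof:
(S1) space–time blow-ups (scale `(N+1)^{1/3}`, Cesàro over mesoscopic windows) of the evolved law are tight (packing)
and every limit point is a translation-invariant FLOW-STATIONARY law of the infinite hard-sphere dynamics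
(`Literature.Analysis.FluidPDE.InfiniteHardSphereFlow`, `IsStationary`; OVY Lemma 4.1 — deterministic, free);
(S2) C⁺ passes to the limit as the weakly closed LINEAR identities `E[Ψ(q)(v v − Θ(q)δδ)] = 0`, `E[Ψ(q) v v v] = 0`;
stationarity tested on `φ(q)·v_j^b` with `tsupport φ` off contacts + order-2 identities ⇒ `Θ·F` has zero distributional
gradient off contacts (`CovarianceRigidityCore`, IdeatorOneSketch, three lines) ⇒ canonical hard-core DLR (Georgii1979)
⇒ with two-block purity (B3) and `ρ̄σ³ ≤ η₁ < η₀` (low-density uniqueness, Ruelle1969 §4) `F =` the Gibbs law at `ρ̄`,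
`Θ = θ̄`; (S3) in/out symmetry of `|g·ω|` at contact from flux stationarity + `|g′·ω| = |g·ω|` (the boundary-trace
statement booked by triage r1-1/r1-2), then thin-shell statistics of the limit = Gibbs pair correlation × moments ≤ 3,
identified with `6(Z−1)` through ensemble equivalence and the pressure-equation hypothesis; UI from (B1). No
classification of stationary velocity LAWS is made (BoltzmannHypothesisBarrier: not in class — moments ≤ 3 only); no
density or collision-tree expansion (NoDensityExpansion/DiluteRegime: not in class). Why it might fail: purity and C⁺
are inputs, so the residual risk is the hard-core canonical-DLR ⇒ Gibbs step at `η₁` beyond Ruelle's radius and the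
trace step for measures charging no contact configuration. Sources: OllaVaradhanYau1993 §4; FritzFunakiLebowitz1994
Thm 1; Georgii1979 (LNM 760); Ruelle1969 §4; GurevichSuhov1976; Spohn1991 Part I §3.2. [folklore] -/
theorem stub_gibbsContactRigidity :
    ∀ η₀ η₁ : ℝ, 0 < η₁ → η₁ < η₀ → (∀ σ : ℝ, 0 < σ → σ ^ 3 < η₀ → ∀ θ : ℝ, 0 < θ → ∀ e : ℝ, 0 < e → ∃ h₀ : ℝ,
      0 < h₀ ∧ ∀ h : ℝ, 0 < h → h < h₀ → ∃ N₀ : ℕ, ∀ N : ℕ, N₀ ≤ N → ∀ Φ : Literature.Analysis.FluidPDE.HardSphereFlow (Literature.Analysis.FluidPDE.Torus.geometry (Fin 3)) (Literature.MathematicalPhysics.KineticTheory.hsDiameter σ N) (N +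
      1), |h⁻¹ * (∫ z, ((N : ℝ) + 1)⁻¹ * ∑ i : Fin (N + 1), ∑ j : Fin (N + 1), (if j ≠ i ∧ σ < (((N : ℝ) + 1) ^
      ((1 : ℝ) / 3)) * Literature.Analysis.FluidPDE.Torus.euclidDist (z i).1 (z j).1 ∧ (((N : ℝ) + 1) ^ ((1 : ℝ) /
      3)) * Literature.Analysis.FluidPDE.Torus.euclidDist (z i).1 (z j).1 ≤ σ * (1 + h) then (1 : ℝ) else 0) ∂(Literature.MathematicalPhysics.KineticTheory.localGibbsLaw σ (fun _ =>
      1) (fun _ => 0) (fun _ => θ) N Φ)) - 6 * (Literature.MathematicalPhysics.KineticTheory.hsCompressibility (σ ^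
      3) - 1)| ≤ e) → ∀ (a₀ θ₀ : (UnitAddTorus (Fin 3)) → ℝ) (u₀ : (UnitAddTorus (Fin 3)) → (EuclideanSpace ℝ (Fin 3))),
      Continuous a₀ → Continuous θ₀ → Continuous u₀ → (∀ x, 0 < a₀ x) → (∀ x, 0 < θ₀ x) → ∃ σ₀ : ℝ, 0 < σ₀ ∧ ∀
      σ : ℝ, 0 < σ → σ < σ₀ → ∀ Φ : (N : ℕ) → Literature.Analysis.FluidPDE.HardSphereFlow (Literature.Analysis.FluidPDE.Torus.geometry (Fin 3)) (Literature.MathematicalPhysics.KineticTheory.hsDiameter σ N) (N +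
      1), (∀ (γ C : ℝ) (φ : ℕ → (UnitAddTorus (Fin 3)) → ℝ), 0 < γ → γ ≤ 1 / 15 → ((∀ N, Literature.Analysis.FunctionSpaces.Torus.IsSmooth (φ N)) ∧
      (∀ N y, 0 ≤ φ N y) ∧ (∀ N, ∫ y, φ N y = 1) ∧ (∀ (N : ℕ) y, ((N : ℝ) + 1) ^ (-γ) ≤ Literature.Analysis.FluidPDE.Torus.euclidDist y 0 →
      φ N y = 0) ∧ (∀ (N : ℕ) y, φ N y ≤ C * ((N : ℝ) + 1) ^ (3 * γ)) ∧ (∀ (N : ℕ) y, ‖Literature.Analysis.FunctionSpaces.Torus.gradient (φ N) y‖ ≤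
      C * ((N : ℝ) + 1) ^ (4 * γ))) →
    let ρb := fun (N : ℕ) (z : Literature.Analysis.FluidPDE.Config (N + 1) (Fin 3) (UnitAddTorus (Fin 3))) (x :
      (UnitAddTorus (Fin 3))) => Literature.MathematicalPhysics.KineticTheory.empiricalDensityField z (fun y =>
      φ N (y - x));
    let mb := fun (N : ℕ) (z : Literature.Analysis.FluidPDE.Config (N + 1) (Fin 3) (UnitAddTorus (Fin 3))) (x :
      (UnitAddTorus (Fin 3))) => Literature.MathematicalPhysics.KineticTheory.empiricalMomentumField z (fun y =>
      φ N (y - x));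
    let Eb := fun (N : ℕ) (z : Literature.Analysis.FluidPDE.Config (N + 1) (Fin 3) (UnitAddTorus (Fin 3))) (x :
      (UnitAddTorus (Fin 3))) => Literature.MathematicalPhysics.KineticTheory.empiricalEnergyField z (fun y =>
      φ N (y - x));
    let ub := fun (N : ℕ) (z : Literature.Analysis.FluidPDE.Config (N + 1) (Fin 3) (UnitAddTorus (Fin 3))) (x :
      (UnitAddTorus (Fin 3))) => (ρb N z x)⁻¹ • mb N z x;
    let θb := fun (N : ℕ) (z : Literature.Analysis.FluidPDE.Config (N + 1) (Fin 3) (UnitAddTorus (Fin 3))) (x :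
      (UnitAddTorus (Fin 3))) => 2 / 3 * (Eb N z x / ρb N z x - ‖mb N z x‖ ^ 2 / (2 * ρb N z x ^ 2)); ∀ (m : ℕ) (W :
      (Fin m → (EuclideanSpace ℝ (Fin 3))) → ℝ) (χ : (UnitAddTorus (Fin 3)) → ℝ), Continuous W → HasCompactSupport W →
      (∀ r, |W r| ≤ 1) → Continuous χ → (∀ x, |χ x| ≤ 1) →
    let w := fun (N : ℕ) (z : Literature.Analysis.FluidPDE.Config (N + 1) (Fin 3) (UnitAddTorus (Fin 3))) (i :
      Fin (N + 1)) (j : Fin m ↪ Fin (N + 1)) => (if ∀ k, j k ≠ i then χ (z i).1 * W (fun k => (((N : ℝ) + 1) ^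
      ((1 : ℝ) / 3)) • Literature.Analysis.FluidPDE.Torus.reprSym ((z (j k)).1 - (z i).1)) else 0);
    let tup := fun (N : ℕ) (i : Fin (N + 1)) (j : Fin m ↪ Fin (N + 1)) => (Matrix.vecCons i (fun k => j k) : Fin (m +
      1) → Fin (N + 1));
    let S₂ := fun (N : ℕ) (z : Literature.Analysis.FluidPDE.Config (N + 1) (Fin 3) (UnitAddTorus (Fin 3))) (k₀ k₁ :
      Fin (m + 1)) (a b : Fin 3) => ((N : ℝ) + 1)⁻¹ * ∑ i : Fin (N + 1), ∑ j : (Fin m ↪ Fin (N + 1)), w N z i j *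
      (((z (tup N i j k₀)).2 a - ub N z (z i).1 a) * ((z (tup N i j k₁)).2 b - ub N z (z i).1 b) - (if k₀ = k₁ ∧
      a = b then θb N z (z i).1 else 0));
    let S₃ := fun (N : ℕ) (z : Literature.Analysis.FluidPDE.Config (N + 1) (Fin 3) (UnitAddTorus (Fin 3))) (k₀ k₁ k₂ :
      Fin (m + 1)) (a b c : Fin 3) => ((N : ℝ) + 1)⁻¹ * ∑ i : Fin (N + 1), ∑ j : (Fin m ↪ Fin (N + 1)), w N z i j *
      (((z (tup N i j k₀)).2 a - ub N z (z i).1 a) * ((z (tup N i j k₁)).2 b - ub N z (z i).1 b) * ((z (tup N i j k₂)).2 c -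
      ub N z (z i).1 c)); ∀ t : ℝ, 0 < t → ∀ δ : ℝ, 0 < δ → (∀ (k₀ k₁ : Fin (m + 1)) (a b : Fin 3), Tendsto (fun N :
      ℕ => Literature.MathematicalPhysics.KineticTheory.localGibbsLaw σ a₀ u₀ θ₀ N (Φ N) {z | δ < |∫ s in Icc 0 t,
      S₂ N ((Φ N).flow s z) k₀ k₁ a b|}) atTop (𝓝 0)) ∧ (∀ (k₀ k₁ k₂ : Fin (m + 1)) (a b c : Fin 3), Tendsto (fun N :
      ℕ => Literature.MathematicalPhysics.KineticTheory.localGibbsLaw σ a₀ u₀ θ₀ N (Φ N) {z | δ < |∫ s in Icc 0 t,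
      S₃ N ((Φ N).flow s z) k₀ k₁ k₂ a b c|}) atTop (𝓝 0))) → (∀ (γ C : ℝ) (φ : ℕ → (UnitAddTorus (Fin 3)) → ℝ),
      0 < γ → γ ≤ 1 / 15 → ((∀ N, Literature.Analysis.FunctionSpaces.Torus.IsSmooth (φ N)) ∧ (∀ N y, 0 ≤ φ N y) ∧
      (∀ N, ∫ y, φ N y = 1) ∧ (∀ (N : ℕ) y, ((N : ℝ) + 1) ^ (-γ) ≤ Literature.Analysis.FluidPDE.Torus.euclidDist y 0 →
      φ N y = 0) ∧ (∀ (N : ℕ) y, φ N y ≤ C * ((N : ℝ) + 1) ^ (3 * γ)) ∧ (∀ (N : ℕ) y, ‖Literature.Analysis.FunctionSpaces.Torus.gradient (φ N) y‖ ≤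
      C * ((N : ℝ) + 1) ^ (4 * γ))) →
    let ρb := fun (N : ℕ) (z : Literature.Analysis.FluidPDE.Config (N + 1) (Fin 3) (UnitAddTorus (Fin 3))) (x :
      (UnitAddTorus (Fin 3))) => Literature.MathematicalPhysics.KineticTheory.empiricalDensityField z (fun y =>
      φ N (y - x));
    let nb := fun (N : ℕ) (z : Literature.Analysis.FluidPDE.Config (N + 1) (Fin 3) (UnitAddTorus (Fin 3))) (i :
      Fin (N + 1)) (R : ℝ) => ∑ j : Fin (N + 1), (if j ≠ i ∧ (((N : ℝ) + 1) ^ ((1 : ℝ) / 3)) * Literature.Analysis.FluidPDE.Torus.euclidDist (z i).1 (z j).1 ≤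
      R then (1 : ℝ) else 0);
    let X := fun (N : ℕ) (z : Literature.Analysis.FluidPDE.Config (N + 1) (Fin 3) (UnitAddTorus (Fin 3))) (t :
      ℝ) => (Φ N).collisionalTransferFunctional (fun (i : Fin (N + 1)) (_ : Fin (N + 1)) (pre post : Literature.Analysis.FluidPDE.Config (N +
      1) (Fin 3) (UnitAddTorus (Fin 3))) => (Pi.single i (Literature.MathematicalPhysics.KineticTheory.hsDiameter σ N *
      ‖(post i).2 - (pre i).2‖) : Fin (N + 1) → ℝ)) z t; ∀ t : ℝ, 0 < t → (∃ c₁ : ℝ, 0 < c₁ ∧ Tendsto (fun N :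
      ℕ => Literature.MathematicalPhysics.KineticTheory.localGibbsLaw σ a₀ u₀ θ₀ N (Φ N) {z | ∃ s ∈ Icc 0 t, ∃
      x : (UnitAddTorus (Fin 3)), ρb N ((Φ N).flow s z) x < c₁ ∨ η₁ < ρb N ((Φ N).flow s z) x * σ ^ 3}) atTop (𝓝 0)) ∧
      (∃ K : ℝ, Tendsto (fun N : ℕ => Literature.MathematicalPhysics.KineticTheory.localGibbsLaw σ a₀ u₀ θ₀ N (Φ N) {z | K <
      ∫ s in Icc 0 t, ∫ y, ‖y.2‖ ^ 6 ∂(Literature.Analysis.FluidPDE.empiricalMeasure ((Φ N).flow s z))}) atTop (𝓝 0)) ∧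
      (∃ K : ℝ, Tendsto (fun N : ℕ => Literature.MathematicalPhysics.KineticTheory.localGibbsLaw σ a₀ u₀ θ₀ N (Φ N) {z | K <
      ((N : ℝ) + 1)⁻¹ * ∑ i : Fin (N + 1), (X N z t i) ^ 2}) atTop (𝓝 0)) ∧ (∀ δ : ℝ, 0 < δ → ∃ R₀ : ℝ, 0 < R₀ ∧
      ∀ R : ℝ, R₀ ≤ R → Tendsto (fun N : ℕ => Literature.MathematicalPhysics.KineticTheory.localGibbsLaw σ a₀ u₀ θ₀ N (Φ N) {z | δ <
      ∫ s in Icc 0 t, ((N : ℝ) + 1)⁻¹ * ∑ i : Fin (N + 1), (nb N ((Φ N).flow s z) i R / (4 / 3 * Real.pi * R ^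
      3) - ρb N ((Φ N).flow s z) (((Φ N).flow s z) i).1) ^ 2}) atTop (𝓝 0))) → ∀ (γ C : ℝ) (φ : ℕ → (UnitAddTorus (Fin 3)) →
      ℝ), 0 < γ → γ ≤ 1 / 15 → ((∀ N, Literature.Analysis.FunctionSpaces.Torus.IsSmooth (φ N)) ∧ (∀ N y, 0 ≤ φ N y) ∧
      (∀ N, ∫ y, φ N y = 1) ∧ (∀ (N : ℕ) y, ((N : ℝ) + 1) ^ (-γ) ≤ Literature.Analysis.FluidPDE.Torus.euclidDist y 0 →
      φ N y = 0) ∧ (∀ (N : ℕ) y, φ N y ≤ C * ((N : ℝ) + 1) ^ (3 * γ)) ∧ (∀ (N : ℕ) y, ‖Literature.Analysis.FunctionSpaces.Torus.gradient (φ N) y‖ ≤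
      C * ((N : ℝ) + 1) ^ (4 * γ))) →
    let ρb := fun (N : ℕ) (z : Literature.Analysis.FluidPDE.Config (N + 1) (Fin 3) (UnitAddTorus (Fin 3))) (x :
      (UnitAddTorus (Fin 3))) => Literature.MathematicalPhysics.KineticTheory.empiricalDensityField z (fun y =>
      φ N (y - x));
    let mb := fun (N : ℕ) (z : Literature.Analysis.FluidPDE.Config (N + 1) (Fin 3) (UnitAddTorus (Fin 3))) (x :
      (UnitAddTorus (Fin 3))) => Literature.MathematicalPhysics.KineticTheory.empiricalMomentumField z (fun y =>
      φ N (y - x));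
    let Eb := fun (N : ℕ) (z : Literature.Analysis.FluidPDE.Config (N + 1) (Fin 3) (UnitAddTorus (Fin 3))) (x :
      (UnitAddTorus (Fin 3))) => Literature.MathematicalPhysics.KineticTheory.empiricalEnergyField z (fun y =>
      φ N (y - x));
    let ub := fun (N : ℕ) (z : Literature.Analysis.FluidPDE.Config (N + 1) (Fin 3) (UnitAddTorus (Fin 3))) (x :
      (UnitAddTorus (Fin 3))) => (ρb N z x)⁻¹ • mb N z x;
    let θb := fun (N : ℕ) (z : Literature.Analysis.FluidPDE.Config (N + 1) (Fin 3) (UnitAddTorus (Fin 3))) (x :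
      (UnitAddTorus (Fin 3))) => 2 / 3 * (Eb N z x / ρb N z x - ‖mb N z x‖ ^ 2 / (2 * ρb N z x ^ 2)); ∀ (G : (EuclideanSpace ℝ (Fin 3)) →
      (EuclideanSpace ℝ (Fin 3)) → ℝ) (χ : (UnitAddTorus (Fin 3)) → ℝ), Continuous (Function.uncurry G) → (∀ n u,
      |G n u| ≤ 1 + ‖u‖) → Continuous χ → (∀ x, |χ x| ≤ 1) →
    let sh := fun (N : ℕ) (z : Literature.Analysis.FluidPDE.Config (N + 1) (Fin 3) (UnitAddTorus (Fin 3))) (i j :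
      Fin (N + 1)) (h : ℝ) => (if j ≠ i ∧ σ < (((N : ℝ) + 1) ^ ((1 : ℝ) / 3)) * Literature.Analysis.FluidPDE.Torus.euclidDist (z i).1 (z j).1 ∧
      (((N : ℝ) + 1) ^ ((1 : ℝ) / 3)) * Literature.Analysis.FluidPDE.Torus.euclidDist (z i).1 (z j).1 ≤ σ * (1 +
      h) then (1 : ℝ) else 0);
    let ω := fun (N : ℕ) (z : Literature.Analysis.FluidPDE.Config (N + 1) (Fin 3) (UnitAddTorus (Fin 3))) (i j :
      Fin (N + 1)) => ((‖Literature.Analysis.FluidPDE.Torus.reprSym ((z i).1 - (z j).1)‖⁻¹ • Literature.Analysis.FluidPDE.Torus.reprSym ((z i).1 -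
      (z j).1)) : (EuclideanSpace ℝ (Fin 3)));
    let gn := fun (N : ℕ) (z : Literature.Analysis.FluidPDE.Config (N + 1) (Fin 3) (UnitAddTorus (Fin 3))) (i j :
      Fin (N + 1)) => min (∑ a : Fin 3, ((z i).2 a - (z j).2 a) * ω N z i j a) 0;
    let Tr := fun (N : ℕ) (z : Literature.Analysis.FluidPDE.Config (N + 1) (Fin 3) (UnitAddTorus (Fin 3))) (h :
      ℝ) => ((N : ℝ) + 1)⁻¹ * ∑ i : Fin (N + 1), ∑ j : Fin (N + 1), χ (z i).1 * sh N z i j h * (gn N z i j) ^ 2 *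
      G (ω N z i j) (ub N z (z i).1);
    let Od := fun (N : ℕ) (z : Literature.Analysis.FluidPDE.Config (N + 1) (Fin 3) (UnitAddTorus (Fin 3))) (h :
      ℝ) (b : Fin 3) => ((N : ℝ) + 1)⁻¹ * ∑ i : Fin (N + 1), ∑ j : Fin (N + 1), χ (z i).1 * sh N z i j h * (gn N z i j) ^
      2 * G (ω N z i j) (ub N z (z i).1) * ((z i).2 b + (z j).2 b - 2 * ub N z (z i).1 b);
    let Gbar := fun (u : (EuclideanSpace ℝ (Fin 3))) => ∫ n : (EuclideanSpace ℝ (Fin 3)), G (‖n‖⁻¹ • n) u * Literature.Analysis.FluidPDE.localMaxwellian 1 1 (0 :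
      (EuclideanSpace ℝ (Fin 3))) n; ∀ t : ℝ, 0 < t → ∀ δ : ℝ, 0 < δ → ∃ h₀ : ℝ, 0 < h₀ ∧ ∀ h : ℝ, 0 < h → h <
      h₀ → Tendsto (fun N : ℕ => Literature.MathematicalPhysics.KineticTheory.localGibbsLaw σ a₀ u₀ θ₀ N (Φ N) {z | δ <
      |h⁻¹ * (∫ s in Icc 0 t, Tr N ((Φ N).flow s z) h) - ∫ s in Icc 0 t, ∫ x, χ x * (ρb N ((Φ N).flow s z) x *
      θb N ((Φ N).flow s z) x * (6 * (Literature.MathematicalPhysics.KineticTheory.hsCompressibility (ρb N ((Φ N).flow s z) x *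
      σ ^ 3) - 1))) * Gbar (ub N ((Φ N).flow s z) x)|}) atTop (𝓝 0) ∧ (∀ b : Fin 3, Tendsto (fun N : ℕ => Literature.MathematicalPhysics.KineticTheory.localGibbsLaw σ a₀ u₀ θ₀ N (Φ N) {z | δ <
      |h⁻¹ * ∫ s in Icc 0 t, Od N ((Φ N).flow s z) h b|}) atTop (𝓝 0)) := by
  sorry

/-- STUB (L — contact read-out / bookkeeping with content). **From the Gibbs contact trace to the crux's tested form.**
At `(σ, Φ)`: IF the Irving–Kirkwood identity holds (the crux's residual `Cc(τ)` is the collision-jump sum `J(τ)` of the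
frozen-time observable, in probability), IF the Gibbs contact trace holds (thin-shell `(g·ω)₋²`-weighted statistics,
trace and odd parts), and IF the a-priori bounds hold (chamber, 6th velocity moment, transfer second moment), THEN the
conclusion of `CollisionalTransferLocality` holds at `(σ, Φ)` for every admissible kernel family, `t`, smooth `(ψ, χ)`
and `δ`. Content: (i) FLUX = TRACE — pathwise, for a hard-sphere trajectory, `Σ_{collisions in (0,τ]} A_ij` equals
`lim_{h→0} (εh)⁻¹ ∫₀^τ Σ_{pairs} 1{shell_h} (g·ω)₋ A_ij ds` (each incoming shell passage lasts `εh/|g·ω|`), and the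
interchange with `N → ∞` is uniform thanks to (B2) (three-body interference during a passage has probability `O(h)`,
grazing passages carry weight `(g·ω)₋ → 0`); (ii) the jumps: `Δv_i = −(g·ω)ω`, `Δ|v_i|²/2 = −(g·ω)(ω·V_cm)`,
`V_cm = ū + (ṽ_i + ṽ_j)/2`, and midpoint Taylor `ψ_s(x_i) − ψ_s(x_j) = ε(ω·∇)ψ_s + O(ε²)` with `ε Σ 1 = O(1)` by (B2), so
`J(τ) = h⁻¹∫₀^τ [Tr-statistic with G = ½ ω⊗ω : ∇ψ_s(x_i), resp. ½ (ω·ū)(ω·∇χ_s)] + [odd statistic] + o(1)`, Riemann sums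
in `s` by smoothness of `(ψ, χ)` on `[0, t]`; (iii) evaluation: `Ḡ = div ψ/6`, resp. `ū·∇χ/6`, so the limit is
`∫∫ ρ̄θ̄ (Z(ρ̄σ³) − 1)(div ψ + ū·∇χ) = ∫∫ (div ψ + ∇χ·ū) p_c(ρ̄, θ̄)` since `p_c = hsPressure σ ρ θ − ρθ = ρθ(Z(ρσ³) − 1)`
definitionally; the odd part is the vanishing collisional heat flux; (iv) `sup_{τ ≤ t}`: both sides are of bounded
variation in `τ` with increments controlled by (B1)–(B2) on a `δ`-grid of `[0, t]`. Hemisphere constants as verified in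
triage (`hemi_check.out`: trace `(2π/3)|g|²`). Sources: IrvingKirkwood1950; ChapmanCowling1970 §16.4; Soto2016 §4.8.1
(4.88)–(4.93); Spohn1991 Part I §3.2 (3.7)–(3.8), (3.15). [folklore] -/
theorem stub_contactReadout :
    ∀ η₁ : ℝ, 0 < η₁ → ∀ (a₀ θ₀ : (UnitAddTorus (Fin 3)) → ℝ) (u₀ : (UnitAddTorus (Fin 3)) → (EuclideanSpace ℝ (Fin 3))),
      Continuous a₀ → Continuous θ₀ → Continuous u₀ → (∀ x, 0 < a₀ x) → (∀ x, 0 < θ₀ x) → ∃ σ₀ : ℝ, 0 < σ₀ ∧ ∀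
      σ : ℝ, 0 < σ → σ < σ₀ → ∀ Φ : (N : ℕ) → Literature.Analysis.FluidPDE.HardSphereFlow (Literature.Analysis.FluidPDE.Torus.geometry (Fin 3)) (Literature.MathematicalPhysics.KineticTheory.hsDiameter σ N) (N +
      1), (∀ t : ℝ, 0 < t → ∀ (ψ : ℝ → (UnitAddTorus (Fin 3)) → (EuclideanSpace ℝ (Fin 3))) (χ : ℝ → (UnitAddTorus (Fin 3)) →
      ℝ), Literature.Analysis.FunctionSpaces.Torus.IsSmoothSpaceTimeOn (Icc 0 t) ψ → Literature.Analysis.FunctionSpaces.Torus.IsSmoothSpaceTimeOn (Icc 0 t) χ →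
    let O := fun (N : ℕ) (s : ℝ) (z : Literature.Analysis.FluidPDE.Config (N + 1) (Fin 3) (UnitAddTorus (Fin 3))) =>
      ∫ y, ((∑ j, ψ s y.1 j * y.2 j) + χ s y.1 * (‖y.2‖ ^ 2 / 2)) ∂(Literature.Analysis.FluidPDE.empiricalMeasure z);
    let Cc := fun (N : ℕ) (z : Literature.Analysis.FluidPDE.Config (N + 1) (Fin 3) (UnitAddTorus (Fin 3))) (τ :
      ℝ) => O N τ ((Φ N).flow τ z) - O N 0 ((Φ N).flow 0 z) - ∫ s in Icc 0 τ, ((∫ y, ((∑ j, Literature.Analysis.FunctionSpaces.Torus.timeDeriv ψ s y.1 j *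
      y.2 j) + Literature.Analysis.FunctionSpaces.Torus.timeDeriv χ s y.1 * (‖y.2‖ ^ 2 / 2)) ∂(Literature.Analysis.FluidPDE.empiricalMeasure ((Φ N).flow s z))) +
      deriv (fun r : ℝ => O N s (Literature.Analysis.FluidPDE.freeFlight (Literature.Analysis.FluidPDE.Torus.geometry (Fin 3)) r ((Φ N).flow s z))) 0);
    let J := fun (N : ℕ) (z : Literature.Analysis.FluidPDE.Config (N + 1) (Fin 3) (UnitAddTorus (Fin 3))) (τ :
      ℝ) => ∑ᶠ s ∈ Literature.Analysis.FluidPDE.collisionTimes (Literature.Analysis.FluidPDE.Torus.geometry (Fin 3)) (Literature.MathematicalPhysics.KineticTheory.hsDiameter σ N) (fun r =>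
      (Φ N).flow r z) ∩ Ioc 0 τ, Literature.Analysis.FluidPDE.collisionJump (O N s) (fun r => (Φ N).flow r z) s; ∀
      δ : ℝ, 0 < δ → Tendsto (fun N : ℕ => Literature.MathematicalPhysics.KineticTheory.localGibbsLaw σ a₀ u₀ θ₀ N (Φ N) {z | ∃
      τ ∈ Icc 0 t, δ < |Cc N z τ - J N z τ|}) atTop (𝓝 0)) → (∀ (γ C : ℝ) (φ : ℕ → (UnitAddTorus (Fin 3)) → ℝ),
      0 < γ → γ ≤ 1 / 15 → ((∀ N, Literature.Analysis.FunctionSpaces.Torus.IsSmooth (φ N)) ∧ (∀ N y, 0 ≤ φ N y) ∧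
      (∀ N, ∫ y, φ N y = 1) ∧ (∀ (N : ℕ) y, ((N : ℝ) + 1) ^ (-γ) ≤ Literature.Analysis.FluidPDE.Torus.euclidDist y 0 →
      φ N y = 0) ∧ (∀ (N : ℕ) y, φ N y ≤ C * ((N : ℝ) + 1) ^ (3 * γ)) ∧ (∀ (N : ℕ) y, ‖Literature.Analysis.FunctionSpaces.Torus.gradient (φ N) y‖ ≤
      C * ((N : ℝ) + 1) ^ (4 * γ))) →
    let ρb := fun (N : ℕ) (z : Literature.Analysis.FluidPDE.Config (N + 1) (Fin 3) (UnitAddTorus (Fin 3))) (x :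
      (UnitAddTorus (Fin 3))) => Literature.MathematicalPhysics.KineticTheory.empiricalDensityField z (fun y =>
      φ N (y - x));
    let mb := fun (N : ℕ) (z : Literature.Analysis.FluidPDE.Config (N + 1) (Fin 3) (UnitAddTorus (Fin 3))) (x :
      (UnitAddTorus (Fin 3))) => Literature.MathematicalPhysics.KineticTheory.empiricalMomentumField z (fun y =>
      φ N (y - x));
    let Eb := fun (N : ℕ) (z : Literature.Analysis.FluidPDE.Config (N + 1) (Fin 3) (UnitAddTorus (Fin 3))) (x :
      (UnitAddTorus (Fin 3))) => Literature.MathematicalPhysics.KineticTheory.empiricalEnergyField z (fun y =>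
      φ N (y - x));
    let ub := fun (N : ℕ) (z : Literature.Analysis.FluidPDE.Config (N + 1) (Fin 3) (UnitAddTorus (Fin 3))) (x :
      (UnitAddTorus (Fin 3))) => (ρb N z x)⁻¹ • mb N z x;
    let θb := fun (N : ℕ) (z : Literature.Analysis.FluidPDE.Config (N + 1) (Fin 3) (UnitAddTorus (Fin 3))) (x :
      (UnitAddTorus (Fin 3))) => 2 / 3 * (Eb N z x / ρb N z x - ‖mb N z x‖ ^ 2 / (2 * ρb N z x ^ 2)); ∀ (G : (EuclideanSpace ℝ (Fin 3)) →
      (EuclideanSpace ℝ (Fin 3)) → ℝ) (χ : (UnitAddTorus (Fin 3)) → ℝ), Continuous (Function.uncurry G) → (∀ n u,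
      |G n u| ≤ 1 + ‖u‖) → Continuous χ → (∀ x, |χ x| ≤ 1) →
    let sh := fun (N : ℕ) (z : Literature.Analysis.FluidPDE.Config (N + 1) (Fin 3) (UnitAddTorus (Fin 3))) (i j :
      Fin (N + 1)) (h : ℝ) => (if j ≠ i ∧ σ < (((N : ℝ) + 1) ^ ((1 : ℝ) / 3)) * Literature.Analysis.FluidPDE.Torus.euclidDist (z i).1 (z j).1 ∧
      (((N : ℝ) + 1) ^ ((1 : ℝ) / 3)) * Literature.Analysis.FluidPDE.Torus.euclidDist (z i).1 (z j).1 ≤ σ * (1 +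
      h) then (1 : ℝ) else 0);
    let ω := fun (N : ℕ) (z : Literature.Analysis.FluidPDE.Config (N + 1) (Fin 3) (UnitAddTorus (Fin 3))) (i j :
      Fin (N + 1)) => ((‖Literature.Analysis.FluidPDE.Torus.reprSym ((z i).1 - (z j).1)‖⁻¹ • Literature.Analysis.FluidPDE.Torus.reprSym ((z i).1 -
      (z j).1)) : (EuclideanSpace ℝ (Fin 3)));
    let gn := fun (N : ℕ) (z : Literature.Analysis.FluidPDE.Config (N + 1) (Fin 3) (UnitAddTorus (Fin 3))) (i j :
      Fin (N + 1)) => min (∑ a : Fin 3, ((z i).2 a - (z j).2 a) * ω N z i j a) 0;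
    let Tr := fun (N : ℕ) (z : Literature.Analysis.FluidPDE.Config (N + 1) (Fin 3) (UnitAddTorus (Fin 3))) (h :
      ℝ) => ((N : ℝ) + 1)⁻¹ * ∑ i : Fin (N + 1), ∑ j : Fin (N + 1), χ (z i).1 * sh N z i j h * (gn N z i j) ^ 2 *
      G (ω N z i j) (ub N z (z i).1);
    let Od := fun (N : ℕ) (z : Literature.Analysis.FluidPDE.Config (N + 1) (Fin 3) (UnitAddTorus (Fin 3))) (h :
      ℝ) (b : Fin 3) => ((N : ℝ) + 1)⁻¹ * ∑ i : Fin (N + 1), ∑ j : Fin (N + 1), χ (z i).1 * sh N z i j h * (gn N z i j) ^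
      2 * G (ω N z i j) (ub N z (z i).1) * ((z i).2 b + (z j).2 b - 2 * ub N z (z i).1 b);
    let Gbar := fun (u : (EuclideanSpace ℝ (Fin 3))) => ∫ n : (EuclideanSpace ℝ (Fin 3)), G (‖n‖⁻¹ • n) u * Literature.Analysis.FluidPDE.localMaxwellian 1 1 (0 :
      (EuclideanSpace ℝ (Fin 3))) n; ∀ t : ℝ, 0 < t → ∀ δ : ℝ, 0 < δ → ∃ h₀ : ℝ, 0 < h₀ ∧ ∀ h : ℝ, 0 < h → h <
      h₀ → Tendsto (fun N : ℕ => Literature.MathematicalPhysics.KineticTheory.localGibbsLaw σ a₀ u₀ θ₀ N (Φ N) {z | δ <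
      |h⁻¹ * (∫ s in Icc 0 t, Tr N ((Φ N).flow s z) h) - ∫ s in Icc 0 t, ∫ x, χ x * (ρb N ((Φ N).flow s z) x *
      θb N ((Φ N).flow s z) x * (6 * (Literature.MathematicalPhysics.KineticTheory.hsCompressibility (ρb N ((Φ N).flow s z) x *
      σ ^ 3) - 1))) * Gbar (ub N ((Φ N).flow s z) x)|}) atTop (𝓝 0) ∧ (∀ b : Fin 3, Tendsto (fun N : ℕ => Literature.MathematicalPhysics.KineticTheory.localGibbsLaw σ a₀ u₀ θ₀ N (Φ N) {z | δ <
      |h⁻¹ * ∫ s in Icc 0 t, Od N ((Φ N).flow s z) h b|}) atTop (𝓝 0))) → (∀ (γ C : ℝ) (φ : ℕ → (UnitAddTorus (Fin 3)) →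
      ℝ), 0 < γ → γ ≤ 1 / 15 → ((∀ N, Literature.Analysis.FunctionSpaces.Torus.IsSmooth (φ N)) ∧ (∀ N y, 0 ≤ φ N y) ∧
      (∀ N, ∫ y, φ N y = 1) ∧ (∀ (N : ℕ) y, ((N : ℝ) + 1) ^ (-γ) ≤ Literature.Analysis.FluidPDE.Torus.euclidDist y 0 →
      φ N y = 0) ∧ (∀ (N : ℕ) y, φ N y ≤ C * ((N : ℝ) + 1) ^ (3 * γ)) ∧ (∀ (N : ℕ) y, ‖Literature.Analysis.FunctionSpaces.Torus.gradient (φ N) y‖ ≤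
      C * ((N : ℝ) + 1) ^ (4 * γ))) →
    let ρb := fun (N : ℕ) (z : Literature.Analysis.FluidPDE.Config (N + 1) (Fin 3) (UnitAddTorus (Fin 3))) (x :
      (UnitAddTorus (Fin 3))) => Literature.MathematicalPhysics.KineticTheory.empiricalDensityField z (fun y =>
      φ N (y - x));
    let nb := fun (N : ℕ) (z : Literature.Analysis.FluidPDE.Config (N + 1) (Fin 3) (UnitAddTorus (Fin 3))) (i :
      Fin (N + 1)) (R : ℝ) => ∑ j : Fin (N + 1), (if j ≠ i ∧ (((N : ℝ) + 1) ^ ((1 : ℝ) / 3)) * Literature.Analysis.FluidPDE.Torus.euclidDist (z i).1 (z j).1 ≤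
      R then (1 : ℝ) else 0);
    let X := fun (N : ℕ) (z : Literature.Analysis.FluidPDE.Config (N + 1) (Fin 3) (UnitAddTorus (Fin 3))) (t :
      ℝ) => (Φ N).collisionalTransferFunctional (fun (i : Fin (N + 1)) (_ : Fin (N + 1)) (pre post : Literature.Analysis.FluidPDE.Config (N +
      1) (Fin 3) (UnitAddTorus (Fin 3))) => (Pi.single i (Literature.MathematicalPhysics.KineticTheory.hsDiameter σ N *
      ‖(post i).2 - (pre i).2‖) : Fin (N + 1) → ℝ)) z t; ∀ t : ℝ, 0 < t → (∃ c₁ : ℝ, 0 < c₁ ∧ Tendsto (fun N :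
      ℕ => Literature.MathematicalPhysics.KineticTheory.localGibbsLaw σ a₀ u₀ θ₀ N (Φ N) {z | ∃ s ∈ Icc 0 t, ∃
      x : (UnitAddTorus (Fin 3)), ρb N ((Φ N).flow s z) x < c₁ ∨ η₁ < ρb N ((Φ N).flow s z) x * σ ^ 3}) atTop (𝓝 0)) ∧
      (∃ K : ℝ, Tendsto (fun N : ℕ => Literature.MathematicalPhysics.KineticTheory.localGibbsLaw σ a₀ u₀ θ₀ N (Φ N) {z | K <
      ∫ s in Icc 0 t, ∫ y, ‖y.2‖ ^ 6 ∂(Literature.Analysis.FluidPDE.empiricalMeasure ((Φ N).flow s z))}) atTop (𝓝 0)) ∧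
      (∃ K : ℝ, Tendsto (fun N : ℕ => Literature.MathematicalPhysics.KineticTheory.localGibbsLaw σ a₀ u₀ θ₀ N (Φ N) {z | K <
      ((N : ℝ) + 1)⁻¹ * ∑ i : Fin (N + 1), (X N z t i) ^ 2}) atTop (𝓝 0)) ∧ (∀ δ : ℝ, 0 < δ → ∃ R₀ : ℝ, 0 < R₀ ∧
      ∀ R : ℝ, R₀ ≤ R → Tendsto (fun N : ℕ => Literature.MathematicalPhysics.KineticTheory.localGibbsLaw σ a₀ u₀ θ₀ N (Φ N) {z | δ <
      ∫ s in Icc 0 t, ((N : ℝ) + 1)⁻¹ * ∑ i : Fin (N + 1), (nb N ((Φ N).flow s z) i R / (4 / 3 * Real.pi * R ^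
      3) - ρb N ((Φ N).flow s z) (((Φ N).flow s z) i).1) ^ 2}) atTop (𝓝 0))) → ∀ (γ C : ℝ) (φ : ℕ → (UnitAddTorus (Fin 3)) →
      ℝ), 0 < γ → γ ≤ 1 / 15 → ((∀ N, Literature.Analysis.FunctionSpaces.Torus.IsSmooth (φ N)) ∧ (∀ N y, 0 ≤ φ N y) ∧
      (∀ N, ∫ y, φ N y = 1) ∧ (∀ (N : ℕ) y, ((N : ℝ) + 1) ^ (-γ) ≤ Literature.Analysis.FluidPDE.Torus.euclidDist y 0 →
      φ N y = 0) ∧ (∀ (N : ℕ) y, φ N y ≤ C * ((N : ℝ) + 1) ^ (3 * γ)) ∧ (∀ (N : ℕ) y, ‖Literature.Analysis.FunctionSpaces.Torus.gradient (φ N) y‖ ≤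
      C * ((N : ℝ) + 1) ^ (4 * γ))) →
    let ρb := fun (N : ℕ) (z : Literature.Analysis.FluidPDE.Config (N + 1) (Fin 3) (UnitAddTorus (Fin 3))) (x :
      (UnitAddTorus (Fin 3))) => Literature.MathematicalPhysics.KineticTheory.empiricalDensityField z (fun y =>
      φ N (y - x));
    let mb := fun (N : ℕ) (z : Literature.Analysis.FluidPDE.Config (N + 1) (Fin 3) (UnitAddTorus (Fin 3))) (x :
      (UnitAddTorus (Fin 3))) => Literature.MathematicalPhysics.KineticTheory.empiricalMomentumField z (fun y =>
      φ N (y - x));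
    let Eb := fun (N : ℕ) (z : Literature.Analysis.FluidPDE.Config (N + 1) (Fin 3) (UnitAddTorus (Fin 3))) (x :
      (UnitAddTorus (Fin 3))) => Literature.MathematicalPhysics.KineticTheory.empiricalEnergyField z (fun y =>
      φ N (y - x));
    let ub := fun (N : ℕ) (z : Literature.Analysis.FluidPDE.Config (N + 1) (Fin 3) (UnitAddTorus (Fin 3))) (x :
      (UnitAddTorus (Fin 3))) => (ρb N z x)⁻¹ • mb N z x;
    let θb := fun (N : ℕ) (z : Literature.Analysis.FluidPDE.Config (N + 1) (Fin 3) (UnitAddTorus (Fin 3))) (x :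
      (UnitAddTorus (Fin 3))) => 2 / 3 * (Eb N z x / ρb N z x - ‖mb N z x‖ ^ 2 / (2 * ρb N z x ^ 2));
    let pc := fun (r th : ℝ) => Literature.MathematicalPhysics.KineticTheory.hsPressure σ r th - r * th; ∀ t :
      ℝ, 0 < t → ∀ (ψ : ℝ → (UnitAddTorus (Fin 3)) → (EuclideanSpace ℝ (Fin 3))) (χ : ℝ → (UnitAddTorus (Fin 3)) →
      ℝ), Literature.Analysis.FunctionSpaces.Torus.IsSmoothSpaceTimeOn (Icc 0 t) ψ → Literature.Analysis.FunctionSpaces.Torus.IsSmoothSpaceTimeOn (Icc 0 t) χ →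
    let O := fun (N : ℕ) (s : ℝ) (z : Literature.Analysis.FluidPDE.Config (N + 1) (Fin 3) (UnitAddTorus (Fin 3))) =>
      ∫ y, ((∑ j, ψ s y.1 j * y.2 j) + χ s y.1 * (‖y.2‖ ^ 2 / 2)) ∂(Literature.Analysis.FluidPDE.empiricalMeasure z);
    let Cc := fun (N : ℕ) (z : Literature.Analysis.FluidPDE.Config (N + 1) (Fin 3) (UnitAddTorus (Fin 3))) (τ :
      ℝ) => O N τ ((Φ N).flow τ z) - O N 0 ((Φ N).flow 0 z) - ∫ s in Icc 0 τ, ((∫ y, ((∑ j, Literature.Analysis.FunctionSpaces.Torus.timeDeriv ψ s y.1 j *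
      y.2 j) + Literature.Analysis.FunctionSpaces.Torus.timeDeriv χ s y.1 * (‖y.2‖ ^ 2 / 2)) ∂(Literature.Analysis.FluidPDE.empiricalMeasure ((Φ N).flow s z))) +
      deriv (fun r : ℝ => O N s (Literature.Analysis.FluidPDE.freeFlight (Literature.Analysis.FluidPDE.Torus.geometry (Fin 3)) r ((Φ N).flow s z))) 0); ∀
      δ : ℝ, 0 < δ → Tendsto (fun N : ℕ => Literature.MathematicalPhysics.KineticTheory.localGibbsLaw σ a₀ u₀ θ₀ N (Φ N) {z | ∃
      τ ∈ Icc 0 t, δ < |Cc N z τ - ∫ s in Icc 0 τ, ∫ x, (Literature.Analysis.FunctionSpaces.Torus.divergence (ψ s) x +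
      ∑ j, Literature.Analysis.FunctionSpaces.Torus.gradient (χ s) x j * ub N ((Φ N).flow s z) x j) * pc (ρb N ((Φ N).flow s z) x) (θb N ((Φ N).flow s z) x)|}) atTop (𝓝 0) := by
  sorry

/-- STUB (M — provable now; the exact identity every line on this crux needs). **The crux's residual IS the collisional
transfer.** For `0 < σ < 1/2`, any profiles, every flow family, every `t > 0` and smooth `(ψ, χ)` on `[0, t]`: with
`O(s, z) = ⟨μ_z, ψ_s·v + χ_s|v|²/2⟩` and `Cc` the verbatim residual of the route decl, the event
`{∃ τ ≤ t, δ < |Cc(τ) − J(τ)|}`, `J(τ) = Σᶠ_{s ∈ collisionTimes ∩ (0, τ]} collisionJump (O s) (orbit) s`, has local-Gibbs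
probability `→ 0` — in fact it is NULL for every `N`: on the good set of the flow (Liouville-conull,
`HardSphereFlow.measure_compl_good`; `localGibbsLaw ≪ liouville`) the orbit is a hard-sphere trajectory and
`IsHardSphereTrajectory.sub_eq_integral_add_finsum_collisionJump_td` with `F s z := O(s, z)` (after a smooth cut-off
of `(ψ, χ)` outside `[0, τ]`) and `F′ s z := ∂_s O(s, z) + d/dr O(s, S_r z)|_{r=0}` (chain rule along free flight; the
crux's integrand, `timeDeriv` two-sided junk only at `s ∈ {0, t}`, Lebesgue-null) gives `Cc(τ) = J(τ)` for all
`τ ∈ [0, t]` (`∫ s in Icc 0 τ` = `∫ s in 0..τ`; `Φ.flow 0 z = z` on the good set). The jumps are then the pair sums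
`(N+1)⁻¹[(ψ(x_i) − ψ(x_j))·Δv_i + (χ(x_i) − χ(x_j))Δ|v_i|²/2]` by `collisionJump_momentumObservable` /
`collisionJump_energyObservable` (used downstream, not here). Sources: IrvingKirkwood1950; Spohn1991 Part I §3.2
(3.3)–(3.8); Soto2016 §4.8.1; in-tree `Literature.Analysis.FluidPDE.CollisionalTransferTimeDep`. [folklore] -/
theorem stub_irvingKirkwoodIdentity :
    ∀ (a₀ θ₀ : (UnitAddTorus (Fin 3)) → ℝ) (u₀ : (UnitAddTorus (Fin 3)) → (EuclideanSpace ℝ (Fin 3))), Continuous a₀ →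
      Continuous θ₀ → Continuous u₀ → (∀ x, 0 < a₀ x) → (∀ x, 0 < θ₀ x) → ∀ σ : ℝ, 0 < σ → σ < 2⁻¹ → ∀ Φ : (N :
      ℕ) → Literature.Analysis.FluidPDE.HardSphereFlow (Literature.Analysis.FluidPDE.Torus.geometry (Fin 3)) (Literature.MathematicalPhysics.KineticTheory.hsDiameter σ N) (N +
      1), ∀ t : ℝ, 0 < t → ∀ (ψ : ℝ → (UnitAddTorus (Fin 3)) → (EuclideanSpace ℝ (Fin 3))) (χ : ℝ → (UnitAddTorus (Fin 3)) →
      ℝ), Literature.Analysis.FunctionSpaces.Torus.IsSmoothSpaceTimeOn (Icc 0 t) ψ → Literature.Analysis.FunctionSpaces.Torus.IsSmoothSpaceTimeOn (Icc 0 t) χ →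
    let O := fun (N : ℕ) (s : ℝ) (z : Literature.Analysis.FluidPDE.Config (N + 1) (Fin 3) (UnitAddTorus (Fin 3))) =>
      ∫ y, ((∑ j, ψ s y.1 j * y.2 j) + χ s y.1 * (‖y.2‖ ^ 2 / 2)) ∂(Literature.Analysis.FluidPDE.empiricalMeasure z);
    let Cc := fun (N : ℕ) (z : Literature.Analysis.FluidPDE.Config (N + 1) (Fin 3) (UnitAddTorus (Fin 3))) (τ :
      ℝ) => O N τ ((Φ N).flow τ z) - O N 0 ((Φ N).flow 0 z) - ∫ s in Icc 0 τ, ((∫ y, ((∑ j, Literature.Analysis.FunctionSpaces.Torus.timeDeriv ψ s y.1 j *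
      y.2 j) + Literature.Analysis.FunctionSpaces.Torus.timeDeriv χ s y.1 * (‖y.2‖ ^ 2 / 2)) ∂(Literature.Analysis.FluidPDE.empiricalMeasure ((Φ N).flow s z))) +
      deriv (fun r : ℝ => O N s (Literature.Analysis.FluidPDE.freeFlight (Literature.Analysis.FluidPDE.Torus.geometry (Fin 3)) r ((Φ N).flow s z))) 0);
    let J := fun (N : ℕ) (z : Literature.Analysis.FluidPDE.Config (N + 1) (Fin 3) (UnitAddTorus (Fin 3))) (τ :
      ℝ) => ∑ᶠ s ∈ Literature.Analysis.FluidPDE.collisionTimes (Literature.Analysis.FluidPDE.Torus.geometry (Fin 3)) (Literature.MathematicalPhysics.KineticTheory.hsDiameter σ N) (fun r =>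
      (Φ N).flow r z) ∩ Ioc 0 τ, Literature.Analysis.FluidPDE.collisionJump (O N s) (fun r => (Φ N).flow r z) s; ∀
      δ : ℝ, 0 < δ → Tendsto (fun N : ℕ => Literature.MathematicalPhysics.KineticTheory.localGibbsLaw σ a₀ u₀ θ₀ N (Φ N) {z | ∃
      τ ∈ Icc 0 t, δ < |Cc N z τ - J N z τ|}) atTop (𝓝 0) := by
  sorry

/-! ### Composition (sorry-free modulo the six stubs) -/

/-- **The line's composition**: the six stubs give `CollisionalTransferLocality` by pure logic — `η₀` from the
pressure equation, density ceiling `η₁ := η₀ / 2` for the chamber, `σ₀` the minimum of the five `σ`-thresholds and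
`1/2`, then at `(σ, Φ)`: read-out ∘ (Irving–Kirkwood identity, engine ∘ (C⁺, bounds), bounds). [folklore] -/
theorem CollisionalTransferLocality_of :
    Summit.AtomisticToContinuum.HydrodynamicLimit.Theses.CollisionIsometryCLT.CollisionalTransferLocality := by
  obtain ⟨η₀, hη₀, hPE⟩ := stub_pressureEquation
  have hη₁ : (0 : ℝ) < η₀ / 2 := half_pos hη₀
  have hη₁' : η₀ / 2 < η₀ := half_lt_self hη₀
  intro a₀ θ₀ u₀ ha hθ hu ha0 hθ0
  obtain ⟨σ₁, hσ₁, H1⟩ := stub_conditionalCovariance a₀ θ₀ u₀ ha hθ hu ha0 hθ0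
  obtain ⟨σ₂, hσ₂, H2⟩ := stub_microstructureBounds (η₀ / 2) hη₁ a₀ θ₀ u₀ ha hθ hu ha0 hθ0
  obtain ⟨σ₄, hσ₄, H4⟩ := stub_gibbsContactRigidity η₀ (η₀ / 2) hη₁ hη₁' hPE a₀ θ₀ u₀ ha hθ hu ha0 hθ0
  obtain ⟨σ₅, hσ₅, H5⟩ := stub_contactReadout (η₀ / 2) hη₁ a₀ θ₀ u₀ ha hθ hu ha0 hθ0
  refine ⟨min (min (min σ₁ σ₂) (min σ₄ σ₅)) 2⁻¹,
    lt_min (lt_min (lt_min hσ₁ hσ₂) (lt_min hσ₄ hσ₅)) (by norm_num), fun σ hσ hσlt Φ => ?_⟩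
  have h12 : σ < min σ₁ σ₂ := lt_of_lt_of_le hσlt ((min_le_left _ _).trans (min_le_left _ _))
  have h45 : σ < min σ₄ σ₅ := lt_of_lt_of_le hσlt ((min_le_left _ _).trans (min_le_right _ _))
  have h1 : σ < σ₁ := lt_of_lt_of_le h12 (min_le_left _ _)
  have h2 : σ < σ₂ := lt_of_lt_of_le h12 (min_le_right _ _)
  have h4 : σ < σ₄ := lt_of_lt_of_le h45 (min_le_left _ _)
  have h5 : σ < σ₅ := lt_of_lt_of_le h45 (min_le_right _ _)
  have h6 : σ < 2⁻¹ := lt_of_lt_of_le hσlt (min_le_right _ _)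
  exact H5 σ hσ h5 Φ (stub_irvingKirkwoodIdentity a₀ θ₀ u₀ ha hθ hu ha0 hθ0 σ hσ h6 Φ)
    (H4 σ hσ h4 Φ (H1 σ hσ h1 Φ) (H2 σ hσ h2 Φ)) (H2 σ hσ h2 Φ)

/-- The same composition read against the `StiffCollisionalRelaxation` copy of the shared item (the two route decls
are one term, `Disproof.shared_verbatim`; definitional transport). [folklore] -/
theorem CollisionalTransferLocality_of' :
    Summit.AtomisticToContinuum.HydrodynamicLimit.Theses.StiffCollisionalRelaxation.CollisionalTransferLocality :=
  CollisionalTransferLocality_of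

end Summit.AtomisticToContinuum.HydrodynamicLimit.Cruxes.CollisionalTransferLocality.ConditionalCovarianceLiouvilleRigidity

end
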